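import Literature.MathematicalPhysics.QuantumFieldTheory.Balaban1983to89.B9Eq342SupNormDecayFromBlockDecayStencil
import Literature.MathematicalPhysics.QuantumFieldTheory.Balaban1983to89.B9Eq316PenaltyStencilLetterTower
import Literature.MathematicalPhysics.QuantumFieldTheory.Balaban1983to89.B9Eq326LocalPartZerothOrderWeightedRow
import Literature.MathematicalPhysics.QuantumFieldTheory.Balaban1983to89.B9Eq342GreenPrimeTowerSupBoundDecayCosh

/-!
# `Balaban1983to89.B9Eq326LocalPartTowerSupDecay` — T. Bałaban, *Propagators for lattice gauge theories in a background field*, Commun. Math. Phys. **99**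
# (1985) 389–434 [Balaban1985BackgroundPropagators] Thm 3.3 (3.47) p. 398 with its decay factor, (3.26) p. 395 (the local part `A₀ = Δ(U) + D_UD*_U + Q*aQ` of
# `Δ_a`), (3.23) p. 394, (3.69) p. 404, (3.49) p. 399, (3.35)–(3.37) p. 396, with [Balaban1985Variational] (134)–(136) p. 298 and [Balaban1984PropagatorsI] p. 36
# (the `cosh` weight): **THE DECAYED SUP ROW OF THE TOWER LOCAL PART — for `A₀,k = Δ(U) + D_UD*_U + Q_k(U)†(a•Q_k(U))` on the bonds of `T_{L^{n+1}m}` and a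
# source `f` supported over ONE unit block `v` with `‖f(b)‖ ≤ F`: `‖(A₀,k⁻¹f)(b₀)‖ ≤ A∕(1 − θ)·e^{−a′·d_m(Π(b₀), v)}·F` at EVERY bond, the constants `A`, `θ`
# assembled from letters each of which is FREE OF THE HEIGHT `n` on print's diagonal `ηL^{n+1} = 1`, `c₀(L^{n+1})^d = c₁`** — the instance of ne9-leaf-03's
# (WKP) `B9Eq342SupNormDecayFromBlockDecayStencil.norm_apply_le_decay_of_letters_stencil` on the BOND graph of the tower (Kato form
# `B9Eq326LocalPartKatoForm.kato_form_localPart`, the `cosh` weight family of the OWNER's `weight_site_letters_tower` read at base points, ne9-leaf-02's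
# LEVEL-FREE (D-FS) letter `hDFS_cosh_site_diag` transported to bonds, the penalty's STENCIL slot by (PSK) `norm_penalty_QkW_apply_le_stencil`, the `L^∞` slot by
# the LOCAL letters of `Δ′` (`B9Eq369CurvOpSupLetter.norm_apply_curvOp_le_local`) and `η⁻²𝒦` (ne9-leaf-05's `norm_weitzOp_apply_le_local`)); (D-E)₀,k — the
# `L²` block decay of `A₀,k⁻¹` — and (T) DISPLAYED (OFFER O-leaf03-g78-1 (c)(i) toward beta-an4's INTERFACE REQUEST D4; the brick, not the END)

statement-level skeleton of published theorems with citation tags; proofs where landed; nothing here is a claim about the Yang–Mills mass gap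

CITATION HEADER (lean-in-tree rule).  Audit cell `pub-balaban`, sub-cell `t4`, BINDER row NE9; filed by NE9 crux-team LEAF PROVER 03 (`b2b-balaban-t4-ne9-formalise-leaf-03`,
gen 78; road ΔA-CT).  Imports this lineage's (WKP) and (PSK) (through them (SBL)∕(SBLT), ne9-leaf-06's `B9Eq342SupNormDecayFromBlockDecay`, ne9-leaf-02's
`B9Eq342SupNormBootstrapWeightedChain`), ne9-leaf-05's `B9Eq326LocalPartZerothOrderWeightedRow` (through it `B9Eq369CurvOpSupLetter`, `B9Eq326LocalPartKatoForm`),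
the OWNER's `B9Eq342GreenPrimeTowerSupBoundDecayCosh` (through it `B9Eq342TowerBigBlocks`, `B9Eq342CoshWeightSite`, `B5Eq129FreeResolventDecayedLetterSiteDiag`).
Sources READ first-hand in the held text layers (`paper:balaban1985-cmp99-background-propagators` p. 393 (3.15)–(3.16), p. 397–399 Thm 3.1∕3.3; `paper:balaban1985-cmp98-averaging`
p. 24, p. 36).  Print proves the sup rows by the random walk of Sect. C; NOTHING of it is reproduced — Kato domination + supersolution weight + the `L²` block
decay, [folklore] composition BY NAME.

WHAT IS PROVED (sorry-free; proof lane — 0 `def`; [folklore]).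
* §1 `hFS_bond_of_site_weighted` (the weighted `k`-chain (D-FS) letter on the bond graph from the site letter: `d` copies of the site graph, slice sum ≤ full sum).
* §2 geometry of the `L^∞` slot at the tower: `one_le_towerP`, `tdist_corner_le_two`, `tdist_plaq_le_two`, `tdist_bigBlock_le_two_of_le_two`.
* §3 **`norm_localInvK_apply_le_decay`** — THE ROW above, every letter displayed: (T) transporter contractions, (D-E)₀,k block decay `‖P_y∘A₀,k⁻¹∘P_v‖ ≤ C_E e^{−κd_m(y,v)}`,
  the data mass `‖f‖ ≤ √μ·F`, the plaquette letters `δ` (`hRe`, `hIm`) and the holonomy letter `δ_𝒦` of the `L^∞` slot, the loop window `Σ_{j<n+1}α_j ≤ A` and the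
  geometric bond window of the stencil slot, the rate `a` with `λ = 1 − 2dη⁻²(cosh a − 1) > 0`, `d ≤ k`, the output rate `0 ≤ a′ ≤ κ`, `a′ ≤ aL^{n+1}`, `2a′ < aL^{n+1}`,
  and the contraction window `θ < 1`.
HONEST SCOPE.  Composition BY NAME; VALUE row of the LOCAL PART only (the Woodbury remainder of `G₁,k` needs storey J at the tower — not here); crude constants;
(D-E)₀,k and (T) displayed; nothing of [B9] Thm 3.1∕3.3∕3.11 asserted, valued or discharged; «NE9 ⇐ the named binders»; NE9 NOT PRINTED ∕ NOT PROVED; row WALLED ON A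
MODEL (O-NE9-1; #5 UNRULED); spine PROVED 0∕9; rung (B)+1 on a finite T⁴ — NOT infinite volume, NOT mass gap, NOT BetaPertH, NOT Clay.  HONEST DEPENDENCY: continuum YM
on T⁴ ⇐ BetaPertH ∧ nine spine estimates (0/9 proved); BetaPertH ⇐ (D1) ∧ (D4) ∧ CAP+tail; G-an2-4 gates asym, D1 and NE2/3/4.  NEW file; nothing modified.  Net new
unproved facts: 0.
-/

noncomputable section

open scoped InnerProductSpace ComplexConjugate BigOperators

namespace Literature.MathematicalPhysics.QuantumFieldTheory.Balaban1983to89.B9Eq326LocalPartTowerSupDecay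

open B4Sect5Torus (TSite tdist tdist_symm tdist_self tdist_triangle tdist_nonneg torusSum_le)
open B4Sect5Proof (latticeConst)
open B4TorusKernel.MultiPeriod (circAbs)
open B9SectCLatticeCarrier (Bond DirPair shift unshift shift_unshift unshift_shift bpos)
open B9Eq311L2Pairing (WL2)
open B11Eq103H1Complex (BondL2K greenK apply_greenK covDerivL2K covDivL2K)
open B9Eq310DeltaPrime (reHol imHol)
open B9Eq310HessianOperator (adTransportW curvOp hessOp)
open B9Eq319QprimeTorus (fineP blockCoord)
open B7Prop1Explicit (U1 Wcx boxVec)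
open B9Eq315QTorus (perCfg cornerSite)
open B9Eq315QTower (towerP towerP_apply UlevOf)
open B9Eq316TowerFlatIsOneStep (towerP_eq_fineP_pow siteCast)
open B9Eq326OperatorTower (QkW)
open B9Eq326LocalPartKatoForm (weitzOpK equiv_weitzOpK kato_form_localPart)
open B9Eq342TowerBigBlocks (mul_tdist_bigBlock_sub_le_tdist)
open B9Eq349BlockDistanceWeight (tdist_shift_le_one)
open B9Eq369CurvOpSupLetter (norm_apply_curvOp_le_local)
open B9Eq326LocalPartZerothOrderWeightedRow (norm_weitzOp_apply_le_local)
open B5Eq129FreeResolventDecayedLetterSiteDiag (hDFS_cosh_site_diag)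
open B9Eq342GreenPrimeTowerSupBoundDecayCosh (weight_site_letters_tower)
open B9Eq342SupNormDecayFromBlockDecayStencil (norm_apply_le_decay_of_letters_stencil)
open B9Eq316PenaltyStencilLetterTower (norm_penalty_QkW_apply_le_stencil tdist_stencil_le_one)

/-! ## §1 The weighted (D-FS) letter on the bond graph from the site letter -/

section FS

variable {d : ℕ} {P : Fin d → ℕ}

/-- **THE WEIGHTED `k`-CHAIN FREE LETTER ON THE BOND GRAPH FROM THE SITE GRAPH**: the bond graph `(x, μ) ∼ (x ± e_ν, μ)` is `d` copies of the site graph, so a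
site letter `ψ_k(x₀) ≤ C₃√(Σ_y c·ψ₀(y)²∕W_{x₀}(y))` for `k`-chains (`0 ≤ C₃`, `0 ≤ c`, `0 < W`) gives the same on bonds with the weight read at base points — the slice
`μ = b₀.2` of a bond chain is a site chain, and the slice sum is dominated by the full sum. [folklore] [cite: Balaban1985BackgroundPropagators, (3.23) p.394, (3.39) p.397] -/
theorem hFS_bond_of_site_weighted {k : ℕ} {w₀ m₁ C₃ c : ℝ} (hC₃ : 0 ≤ C₃) (hc : 0 ≤ c) (Wt : TSite d P → TSite d P → ℝ)
    (hWt : ∀ x₀ y, 0 < Wt x₀ y)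
    (hFS : ∀ (x₀ : TSite d P) (ψ : ℕ → TSite d P → ℝ),
      (∀ j < k, ∀ x, ∑ i : Fin d ⊕ Fin d, w₀ * (ψ (j + 1) x - ψ (j + 1) (Sum.elim (fun ν => unshift ν x) (fun ν => shift ν x) i)) +
        m₁ * ψ (j + 1) x = ψ j x) →
      ψ k x₀ ≤ C₃ * Real.sqrt (∑ y, c * ψ 0 y ^ 2 / Wt x₀ y))
    (b₀ : Bond d P) (φ : ℕ → Bond d P → ℝ)
    (hφ : ∀ j < k, ∀ b : Bond d P, ∑ i : Fin d ⊕ Fin d,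
      w₀ * (φ (j + 1) b - φ (j + 1) (Sum.elim (fun ν => (unshift ν b.1, b.2)) (fun ν => (shift ν b.1, b.2)) i)) + m₁ * φ (j + 1) b = φ j b) :
    φ k b₀ ≤ C₃ * Real.sqrt (∑ b : Bond d P, c * φ 0 b ^ 2 / Wt b₀.1 b.1) := by
  obtain ⟨x₀, μ⟩ := b₀
  have hs := hFS x₀ (fun j y => φ j (y, μ)) (fun j hj y => by
    have h := hφ j hj (y, μ)
    have e : ∀ i : Fin d ⊕ Fin d, (Sum.elim (fun ν => (unshift ν y, μ)) (fun ν => (shift ν y, μ)) i : Bond d P) =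
        (Sum.elim (fun ν => unshift ν y) (fun ν => shift ν y) i, μ) := fun i => by rcases i with ν | ν <;> rfl
    simpa only [e] using h)
  refine hs.trans (mul_le_mul_of_nonneg_left (Real.sqrt_le_sqrt ?_) hC₃)
  rw [Fintype.sum_prod_type]
  exact Finset.sum_le_sum fun y _ => Finset.single_le_sum (f := fun ν => c * φ 0 (y, ν) ^ 2 / Wt x₀ y)
    (fun ν _ => div_nonneg (mul_nonneg hc (sq_nonneg _)) (hWt x₀ y).le) (Finset.mem_univ μ)

end FS

/-! ## §2 Geometry of the `L^∞` slot: plaquette bonds and Weitzenböck corners lie within two fine steps, hence within two unit blocks -/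

section Geometry

variable {d : ℕ} (L : ℕ) [NeZero L] (m : Fin d → ℕ) [∀ i, NeZero (m i)] (n : ℕ)

omit [∀ i, NeZero (m i)] in
/-- The tower's periods are `≥ 1`. [folklore] [cite: Balaban1985Averaging, (1)–(2) p.17] -/
theorem one_le_towerP (hm : ∀ i, 1 ≤ m i) (i : Fin d) : 1 ≤ towerP L m (n + 1) i := by
  rw [towerP_apply]; exact Nat.one_le_iff_ne_zero.mpr (Nat.mul_ne_zero (pow_ne_zero _ (NeZero.ne L)) (by have := hm i; omega))

omit [∀ i, NeZero (m i)] in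
/-- **A WEITZENBÖCK CORNER IS TWO FINE STEPS AWAY**: `d(x, x + e_μ − e_ν) ≤ 2`. [folklore] [cite: Balaban1985Variational, (135) p.298; Balaban1985BackgroundPropagators, (3.69) p.404] -/
theorem tdist_corner_le_two (hm : ∀ i, 1 ≤ m i) (x : TSite d (towerP L m (n + 1))) (μ ν : Fin d) :
    tdist (towerP L m (n + 1)) x (shift μ (unshift ν x)) ≤ 2 := by
  have hP := one_le_towerP L m n hm
  have h1 : tdist (towerP L m (n + 1)) x (unshift ν x) ≤ 1 := by
    have h := tdist_shift_le_one hP (unshift ν x) ν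
    rwa [shift_unshift, tdist_symm hP] at h
  have h2 := tdist_shift_le_one hP (unshift ν x) μ
  linarith [tdist_triangle hP x (unshift ν x) (shift μ (unshift ν x))]

omit [∀ i, NeZero (m i)] in
/-- **TWO BONDS OF ONE PLAQUETTE HAVE BASE POINTS TWO FINE STEPS APART**: the base points of `(x, κ)`, `(x, κ′)`, `(x + e_κ, κ′)`, `(x + e_{κ′}, κ)` are pairwise at
distance `≤ 2`. [folklore] [cite: Balaban1985BackgroundPropagators, (3.2) p.390, (3.69) p.404] -/
theorem tdist_plaq_le_two (hm : ∀ i, 1 ≤ m i) (x : TSite d (towerP L m (n + 1))) (q : DirPair d) (b b' : Bond d (towerP L m (n + 1)))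
    (hb : b = (x, q.1.1) ∨ b = (x, q.1.2) ∨ b = (shift q.1.1 x, q.1.2) ∨ b = (shift q.1.2 x, q.1.1))
    (hb' : b' = (x, q.1.1) ∨ b' = (x, q.1.2) ∨ b' = (shift q.1.1 x, q.1.2) ∨ b' = (shift q.1.2 x, q.1.1)) :
    tdist (towerP L m (n + 1)) b.1 b'.1 ≤ 2 := by
  have hP := one_le_towerP L m n hm
  -- every base point is within one step of `x`
  have hx : ∀ c : Bond d (towerP L m (n + 1)), (c = (x, q.1.1) ∨ c = (x, q.1.2) ∨ c = (shift q.1.1 x, q.1.2) ∨ c = (shift q.1.2 x, q.1.1)) →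
      tdist (towerP L m (n + 1)) x c.1 ≤ 1 := by
    intro c hc
    rcases hc with h | h | h | h <;> rw [h]
    · rw [tdist_self]; exact zero_le_one
    · rw [tdist_self]; exact zero_le_one
    · exact tdist_shift_le_one hP x q.1.1
    · exact tdist_shift_le_one hP x q.1.2
  have h1 := hx b hb
  have h2 := hx b' hb'
  rw [tdist_symm hP] at h1
  linarith [tdist_triangle hP b.1 x b'.1]

omit [∀ i, NeZero (m i)] in
/-- **TWO FINE STEPS STAY WITHIN TWO UNIT BLOCKS**: `d_{(L^{n+1}m)}(x, x′) ≤ 2 ⟹ d_m(Πx, Πx′) ≤ 2` (ne9-leaf-03's `mul_tdist_bigBlock_sub_le_tdist`: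
`L^{n+1}·d_m − (L^{n+1} − 1) ≤ 2`). [folklore] [cite: Balaban1985BackgroundPropagators, (3.49) p.399; Balaban1985Averaging, (2) p.17] -/
theorem tdist_bigBlock_le_two_of_le_two (hm : ∀ i, 1 ≤ m i) {x x' : TSite d (towerP L m (n + 1))} (h : tdist (towerP L m (n + 1)) x x' ≤ 2) :
    tdist m (blockCoord (L ^ (n + 1)) m (siteCast (towerP_eq_fineP_pow L m (n + 1)) x))
      (blockCoord (L ^ (n + 1)) m (siteCast (towerP_eq_fineP_pow L m (n + 1)) x')) ≤ 2 := by
  have hL1 : (1 : ℝ) ≤ (L : ℝ) ^ (n + 1) := one_le_pow₀ (by exact_mod_cast Nat.one_le_iff_ne_zero.mpr (NeZero.ne L))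
  have hg := mul_tdist_bigBlock_sub_le_tdist L m (n + 1) hm x x'
  set D := tdist m (blockCoord (L ^ (n + 1)) m (siteCast (towerP_eq_fineP_pow L m (n + 1)) x))
      (blockCoord (L ^ (n + 1)) m (siteCast (towerP_eq_fineP_pow L m (n + 1)) x'))
  have hD0 : 0 ≤ D := tdist_nonneg _ _ _
  by_contra hD
  rw [not_le] at hD
  -- `L^{n+1}·D ≤ 2 + L^{n+1} − 1 = L^{n+1} + 1 < 2L^{n+1} ≤ L^{n+1}·D`
  nlinarith

end Geometry

/-! ## §3 The decayed sup row of the tower local part -/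

section Instance

variable {d : ℕ} (L : ℕ) [NeZero L] (m : Fin d → ℕ) [∀ i, NeZero (m i)] (n : ℕ)
  {𝔸 : Type*} [NormedRing 𝔸] [StarRing 𝔸] [NormedAlgebra ℂ 𝔸] [StarModule ℂ 𝔸] [CompleteSpace 𝔸] [NormOneClass 𝔸]
  {W : Type*} [NormedAddCommGroup W] [InnerProductSpace ℂ W] [FiniteDimensional ℂ W] (φ : W ≃ₗ[ℂ] 𝔸) {c₀ c₁ : ℝ} [Fact (0 < c₀)] [Fact (0 < c₁)]
  (U : Bond d (towerP L m (n + 1)) → 𝔸ˣ) (hL : 1 ≤ L) (α : ℕ → ℝ) (hα0 : ∀ j, 0 ≤ α j) (hα1 : ∀ j, α j ≤ 1 / 64)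
  (hU1 : ∀ (j : ℕ) (x : B7Prop1Explicit.Site d) (κ : Fin d), perCfg (towerP L m (j + 1)) (UlevOf L m (n + 1) U j) x κ ∈ U1 𝔸)
  (hreg : ∀ (j : ℕ) (y : TSite d (towerP L m j)) (κ : Fin d) (r : Fin d → Fin L),
    ‖((Wcx L (perCfg (towerP L m (j + 1)) (UlevOf L m (n + 1) U j)) (cornerSite L y) κ (boxVec L r) : 𝔸ˣ) : 𝔸) - 1‖ ≤ α j)
  {Mφ Mφ' : ℝ} (hMφ : 0 ≤ Mφ) (hφ : ∀ w, ‖φ w‖ ≤ Mφ * ‖w‖) (hMφ' : 0 ≤ Mφ') (hφ' : ∀ X, ‖φ.symm X‖ ≤ Mφ' * ‖X‖) (hstar : ∀ X : 𝔸, ‖star X‖ ≤ ‖X‖)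
  (εU : ℕ → ℝ) (hεU : ∀ j, 0 ≤ εU j)
  (hUε : ∀ (j : ℕ) (b : Bond d (towerP L m (j + 1))), ‖(UlevOf L m (n + 1) U j b : 𝔸) - 1‖ ≤ εU j)
  {r εs : ℝ} (hr0 : 0 ≤ r) (hr1 : r < 1) (hεs : 0 ≤ εs) (hεg : ∀ j < n + 1, εU j ≤ εs * r ^ j)
  (τ : 𝔸 →ₗ[ℂ] ℂ) {Mτ : ℝ} (hτ : ∀ X Y : 𝔸, ‖τ (X * Y)‖ ≤ Mτ * ‖X‖ * ‖Y‖) (hMτ : 0 ≤ Mτ)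
  (η : ℝ) (hU : ∀ b, ‖(U b : 𝔸)‖ ≤ 1 ∧ ‖(((U b)⁻¹ : 𝔸ˣ) : 𝔸)‖ ≤ 1) {δ : ℝ} (hδ : 0 ≤ δ)
  (hRe : ∀ p : B9SectCLatticeCarrier.Plaq d (towerP L m (n + 1)), ‖reHol U p - 1‖ ≤ δ)
  (hIm : ∀ p : B9SectCLatticeCarrier.Plaq d (towerP L m (n + 1)), ‖imHol U p‖ ≤ δ)
  {δK : ℝ} (hδK : 0 ≤ δK)
  (hHol : ∀ (x : TSite d (towerP L m (n + 1))) (μ ν : Fin d), μ ≠ ν → ∀ v : W,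
    ‖adTransportW φ (fun b => (U b)⁻¹) (unshift ν x, ν) (adTransportW φ U (unshift ν x, μ) v) -
        adTransportW φ U (x, μ) (adTransportW φ (fun b => (U b)⁻¹) (shift μ (unshift ν x), ν) v)‖ ≤ δK * ‖v‖)
  {PB : TSite d m → BondL2K ℂ d (towerP L m (n + 1)) c₀ W →L[ℂ] BondL2K ℂ d (towerP L m (n + 1)) c₀ W}
  (hPB : ∀ (y : TSite d m) (f : BondL2K ℂ d (towerP L m (n + 1)) c₀ W) (b : Bond d (towerP L m (n + 1))),
    WL2.equiv ℂ (fun _ : Bond d (towerP L m (n + 1)) => c₀) W (PB y f) b =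
      if blockCoord (L ^ (n + 1)) m (siteCast (towerP_eq_fineP_pow L m (n + 1)) b.1) = y then
        WL2.equiv ℂ (fun _ : Bond d (towerP L m (n + 1)) => c₀) W f b else 0)

include hα0 hMφ hφ hMφ' hφ' hstar hεU hUε hr0 hr1 hεs hεg hτ hMτ hU hδ hRe hIm hδK hHol hPB in
/-- **THE DECAYED SUP ROW OF THE TOWER LOCAL PART `A₀,k⁻¹`, EVERY LETTER DISPLAYED.**  On the bonds of `T_{L^{n+1}m}` (`1 ≤ m_i`, `1 ≤ d ≤ k`), for
`A₀ = Δ(U) + D_UD*_U + Q_k(U)†(a•Q_k(U))` positive (`hpos₀`), with: (T) contractive transporters `hR`, `hS`; (D-E)₀,k the `L²` block decay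
`‖P_y ∘ A₀⁻¹ ∘ P_v‖ ≤ C_E·e^{−κ·d_m(y,v)}`; the source `f` supported over the unit block `v`, `‖f(b)‖ ≤ F`, `‖f‖ ≤ √μ·F`; the diagonal `c₀(L^{n+1})^d = c₁`, the
loop window `Σ_{j<n+1}α_j ≤ A_Q`, the geometric bond window; the plaquette letters `δ` and the holonomy letter `δ_𝒦`; a fine rate `0 ≤ a` with
`λ := 1 − 2dη⁻²(cosh a − 1) > 0`, `0 < η⁻¹ ≤ L^{n+1}m_ν`, `c₀η^{−d} = c₁`; an output rate `0 ≤ a′ ≤ κ`, `a′ ≤ aL^{n+1}`, `2a′ < aL^{n+1}`; and the contraction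
window `θ := 2e^{a(L^{n+1}−1)}·p_∞·e^{2a′}∕λ·Σ_{l<k}λ^{−l} < 1`, `p_∞ = p_K + ‖η⁻¹‖²(d−1)δ_𝒦`, `p_K = 768·|DirPair d|·M_τ·M_φ²·(‖η^d‖∕c₀)·‖η⁻¹‖²·δ`.  THEN at every bond
`‖(A₀⁻¹f)(b₀)‖ ≤ A∕(1 − θ)·e^{−a′·d_m(Π(b₀), v)}·F`,
`A = 2e^{a(L^{n+1}−1)}(1 + p₂(2d+1)e^{κ}C_E√μ)∕λ·Σ_{l<k}λ^{−l} + C₃·C_E·√(2e^{a(L^{n+1}−1)}·K_d(aL^{n+1} − 2a′))·√μ`, `C₃ = √(3^d∕c₁·λ^{−k})`,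
`p₂ = |a|·M_φ′M_φe^{100d(d+1)L^dA_Q}·2d·2C_Q∕√c₁` — print's «|(Gλ)(x)| ≤ B₀e^{−δ₀d(y,y′)}|λ|, supp λ ⊂ Δ(y′)» SHAPE for the local part, with NO `(L^{n+1})^{d∕2}`.
[cite: Balaban1985BackgroundPropagators, Thm 3.3 (3.47) p.398, Thm 3.1 (3.42) p.397, (3.26) p.395, (3.23) p.394, (3.69) p.404, (3.49) p.399, (3.35)–(3.37) p.396;
Balaban1985Variational, (134)–(136) p.298; Balaban1984PropagatorsI, p.36] -/
theorem norm_localInvK_apply_le_decay [DecidableEq (Bond d (towerP L m (n + 1)))] (hm : ∀ i, 1 ≤ m i) (hd : 1 ≤ d) {k : ℕ} (hk : d ≤ k)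
    (hR : ∀ b w, ‖adTransportW φ U b w‖ ≤ ‖w‖) (hS : ∀ b w, ‖adTransportW φ (fun b => (U b)⁻¹) b w‖ ≤ ‖w‖)
    (a : ℝ) (A₀ : BondL2K ℂ d (towerP L m (n + 1)) c₀ W →ₗ[ℂ] BondL2K ℂ d (towerP L m (n + 1)) c₀ W)
    (hA₀ : A₀ = hessOp φ η U τ + covDerivL2K ℂ c₀ ((η : ℂ))⁻¹ (adTransportW φ U) ∘ₗ covDivL2K ℂ c₀ ((η : ℂ))⁻¹ (adTransportW φ fun b => (U b)⁻¹) +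
      LinearMap.adjoint (QkW L m n φ U hL α hα1 hU1 hreg (c₀ := c₀) (c₁ := c₁)) ∘ₗ ((a : ℂ) • QkW L m n φ U hL α hα1 hU1 hreg (c₀ := c₀) (c₁ := c₁)))
    (hpos₀ : ∀ x : BondL2K ℂ d (towerP L m (n + 1)) c₀ W, x ≠ 0 → 0 < RCLike.re ⟪x, A₀ x⟫_ℂ)
    {CE κ : ℝ} (hCE : 0 ≤ CE) (v : TSite d m)
    (hdec : ∀ y, ‖PB y ∘L LinearMap.toContinuousLinearMap (greenK A₀ hpos₀) ∘L PB v‖ ≤ CE * Real.exp (-(κ * tdist m y v)))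
    (f : BondL2K ℂ d (towerP L m (n + 1)) c₀ W)
    (hfv : ∀ b, blockCoord (L ^ (n + 1)) m (siteCast (towerP_eq_fineP_pow L m (n + 1)) b.1) ≠ v →
      WL2.equiv ℂ (fun _ : Bond d (towerP L m (n + 1)) => c₀) W f b = 0)
    {F : ℝ} (hF0 : 0 ≤ F) (hF : ∀ b, ‖WL2.equiv ℂ (fun _ : Bond d (towerP L m (n + 1)) => c₀) W f b‖ ≤ F) {μ : ℝ} (hμ : ‖f‖ ≤ Real.sqrt μ * F)
    (hw : c₀ * ((L : ℝ) ^ (n + 1)) ^ d = c₁) {AQ : ℝ} (hAQ : ∑ j ∈ Finset.range (n + 1), α j ≤ AQ)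
    {afine : ℝ} (hafine : 0 ≤ afine) (hlam : 0 < 1 - 2 * d * (η⁻¹) ^ 2 * (Real.cosh afine - 1))
    (ht : 0 < η⁻¹) (hc₁ : c₀ * (η⁻¹) ^ d = c₁) (hvol : ∀ ν, η⁻¹ ≤ (towerP L m (n + 1) ν : ℝ))
    {a' : ℝ} (ha' : 0 ≤ a') (ha'κ : a' ≤ κ) (ha'κ₁ : a' ≤ afine * (L : ℝ) ^ (n + 1)) (h2a' : 2 * a' < afine * (L : ℝ) ^ (n + 1))
    (hθ : Real.exp (afine * ((L : ℝ) ^ (n + 1) - 1)) * 2 *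
        ((768 * Fintype.card (DirPair d) * Mτ * Mφ ^ 2 * (‖((η : ℂ)) ^ d‖ / c₀) * ‖((η : ℂ))⁻¹‖ ^ 2 * δ +
            ‖((η : ℂ))⁻¹ * ((η : ℂ))⁻¹‖ * ((d - 1 : ℝ) * δK)) * Real.exp (a' * 2)) /
          (1 - 2 * d * (η⁻¹) ^ 2 * (Real.cosh afine - 1)) *
        ∑ l ∈ Finset.range k, (1 / (1 - 2 * d * (η⁻¹) ^ 2 * (Real.cosh afine - 1))) ^ l < 1)
    (b₀ : Bond d (towerP L m (n + 1))) :
    ‖WL2.equiv ℂ (fun _ : Bond d (towerP L m (n + 1)) => c₀) W (greenK A₀ hpos₀ f) b₀‖ ≤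
      (Real.exp (afine * ((L : ℝ) ^ (n + 1) - 1)) * 2 *
            (1 + |a| * (Mφ' * Mφ * Real.exp (100 * d * (d + 1) * (L : ℝ) ^ d * AQ) * ((2 * d : ℕ) : ℝ) *
                ((Mφ' * Mφ * Real.exp (Real.sqrt ((L : ℝ) ^ d) * (Real.sqrt (2 * d) * (102 * (d + 1) ^ 2 * L)) * (εs / (1 - r)))) / Real.sqrt c₁ * 2)) *
              (Fintype.card (Option (Fin d × Bool)) * Real.exp (κ * 1)) * CE * Real.sqrt μ) /
            (1 - 2 * d * (η⁻¹) ^ 2 * (Real.cosh afine - 1)) *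
          ∑ l ∈ Finset.range k, (1 / (1 - 2 * d * (η⁻¹) ^ 2 * (Real.cosh afine - 1))) ^ l +
        1 ^ k * Real.sqrt (3 ^ d / c₁ * ((1 - 2 * d * (η⁻¹) ^ 2 * (Real.cosh afine - 1)) ^ k)⁻¹) * CE *
          Real.sqrt (Real.exp (afine * ((L : ℝ) ^ (n + 1) - 1)) * 2 * latticeConst d (afine * (L : ℝ) ^ (n + 1) - 2 * a')) * Real.sqrt μ) /
      (1 - Real.exp (afine * ((L : ℝ) ^ (n + 1) - 1)) * 2 *
        ((768 * Fintype.card (DirPair d) * Mτ * Mφ ^ 2 * (‖((η : ℂ)) ^ d‖ / c₀) * ‖((η : ℂ))⁻¹‖ ^ 2 * δ +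
            ‖((η : ℂ))⁻¹ * ((η : ℂ))⁻¹‖ * ((d - 1 : ℝ) * δK)) * Real.exp (a' * 2)) /
          (1 - 2 * d * (η⁻¹) ^ 2 * (Real.cosh afine - 1)) *
        ∑ l ∈ Finset.range k, (1 / (1 - 2 * d * (η⁻¹) ^ 2 * (Real.cosh afine - 1))) ^ l) *
      Real.exp (-(a' * tdist m (blockCoord (L ^ (n + 1)) m (siteCast (towerP_eq_fineP_pow L m (n + 1)) b₀.1)) v)) * F := by
  classical
  subst hA₀
  have hP := one_le_towerP L m n hm
  have hc₀ : (0 : ℝ) < c₀ := Fact.out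
  set lam : ℝ := 1 - 2 * d * (η⁻¹) ^ 2 * (Real.cosh afine - 1) with hlam_def
  -- the solution and the Kato form of the local part
  set u := greenK _ hpos₀ f with hu_def
  set G : BondL2K ℂ d (towerP L m (n + 1)) c₀ W →L[ℂ] BondL2K ℂ d (towerP L m (n + 1)) c₀ W := LinearMap.toContinuousLinearMap (greenK _ hpos₀)
    with hG_def
  have hGf : G f = u := rfl
  set q : BondL2K ℂ d (towerP L m (n + 1)) c₀ W := (curvOp φ τ η U +
      LinearMap.adjoint (QkW L m n φ U hL α hα1 hU1 hreg (c₀ := c₀) (c₁ := c₁)) ∘ₗ ((a : ℂ) • QkW L m n φ U hL α hα1 hU1 hreg (c₀ := c₀) (c₁ := c₁)) -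
      (((η : ℂ))⁻¹ * ((η : ℂ))⁻¹) • weitzOpK ℂ c₀ (adTransportW φ U) (adTransportW φ fun b => (U b)⁻¹) :
        BondL2K ℂ d (towerP L m (n + 1)) c₀ W →ₗ[ℂ] BondL2K ℂ d (towerP L m (n + 1)) c₀ W) u with hq_def
  let nbr : Bond d (towerP L m (n + 1)) → Fin d ⊕ Fin d → Bond d (towerP L m (n + 1)) :=
    fun b j => Sum.elim (fun ν => (unshift ν b.1, b.2)) (fun ν => (shift ν b.1, b.2)) j
  let T : Bond d (towerP L m (n + 1)) → Fin d ⊕ Fin d → W →ₗ[ℂ] W :=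
    fun b j => Sum.elim (fun ν => adTransportW φ (fun b => (U b)⁻¹) (unshift ν b.1, ν)) (fun ν => adTransportW φ U (b.1, ν)) j
  have hT : ∀ b j z, ‖T b j z‖ ≤ ‖z‖ := fun b j z => by
    rcases j with ν | ν
    · exact hS _ z
    · exact hR _ z
  have hsol := apply_greenK hpos₀ f
  have hu : ∀ b, ∑ j, ((((η⁻¹) ^ 2 : ℝ) : ℂ)) • (WL2.equiv ℂ _ W (G f) b - T b j (WL2.equiv ℂ _ W (G f) (nbr b j))) =
      WL2.equiv ℂ _ W f b - WL2.equiv ℂ _ W q b := by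
    intro b
    have h := kato_form_localPart φ η U τ (QkW L m n φ U hL α hα1 hU1 hreg (c₀ := c₀) (c₁ := c₁)) a (c₀ := c₀) u b
    rw [hsol] at h
    rw [hGf]
    exact h
  -- the block map, the weight family, the (W) letters at the tower
  let π : Bond d (towerP L m (n + 1)) → TSite d m := fun b => blockCoord (L ^ (n + 1)) m (siteCast (towerP_eq_fineP_pow L m (n + 1)) b.1)
  let Wf : Bond d (towerP L m (n + 1)) → Bond d (towerP L m (n + 1)) → ℝ := fun x₀ b =>
    ∏ μ, Real.cosh (afine * (circAbs (towerP L m (n + 1) μ)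
      (((((x₀.1 μ : ℕ) : ZMod (towerP L m (n + 1) μ)) - ((b.1 μ : ℕ) : ZMod (towerP L m (n + 1) μ))).val : ℕ) : ℤ) : ℝ))
  have hWL : ∀ x₀ : Bond d (towerP L m (n + 1)), _ := fun x₀ => weight_site_letters_tower L m n η hafine x₀.1
  have hW0 : ∀ x₀ b, 0 < Wf x₀ b := fun x₀ b => (hWL x₀).1 b.1
  have hx₀ : ∀ x₀, Wf x₀ x₀ = 1 := fun x₀ => (hWL x₀).2.1
  have hsup : ∀ x₀ b, lam * Wf x₀ b ≤ ∑ j, (η⁻¹) ^ 2 * (Wf x₀ b - Wf x₀ (nbr b j)) + 1 * Wf x₀ b := by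
    intro x₀ b
    refine ((hWL x₀).2.2.1 b.1).trans (le_of_eq ?_)
    congr 1
    refine Finset.sum_congr rfl fun j _ => ?_
    rcases j with ν | ν <;> rfl
  have hWd : ∀ x₀ b, Real.exp (afine * (L : ℝ) ^ (n + 1) * tdist m (π x₀) (π b)) ≤ Real.exp (afine * ((L : ℝ) ^ (n + 1) - 1)) * 2 * Wf x₀ b :=
    fun x₀ b => (hWL x₀).2.2.2 b.1
  -- the (D-FS) letter on the bond graph, at every centre
  have hC₃ : 0 ≤ Real.sqrt (3 ^ d / c₁ * (lam ^ k)⁻¹) := Real.sqrt_nonneg _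
  have hFS : ∀ (x₀ : Bond d (towerP L m (n + 1))) (ψ : ℕ → Bond d (towerP L m (n + 1)) → ℝ), (∀ y, 0 ≤ ψ 0 y) →
      (∀ j < k, ∀ x, ∑ i, (η⁻¹) ^ 2 * (ψ (j + 1) x - ψ (j + 1) (nbr x i)) + 1 * ψ (j + 1) x = ψ j x) →
      ψ k x₀ ≤ Real.sqrt (3 ^ d / c₁ * (lam ^ k)⁻¹) * Real.sqrt (∑ y, c₀ * ψ 0 y ^ 2 / Wf x₀ y) := by
    intro x₀ ψ _ hψ
    exact hFS_bond_of_site_weighted hC₃ hc₀.le (fun x₀' y => ∏ μ, Real.cosh (afine * (circAbs (towerP L m (n + 1) μ)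
        (((((x₀' μ : ℕ) : ZMod (towerP L m (n + 1) μ)) - ((y μ : ℕ) : ZMod (towerP L m (n + 1) μ))).val : ℕ) : ℤ) : ℝ)))
      (fun x₀' y => B9Eq342CoshWeightSite.weight_site_pos (towerP L m (n + 1)) afine x₀' y)
      (fun x₀' ψ' hψ' => hDFS_cosh_site_diag (towerP L m (n + 1)) hk afine η ht hc₀ hc₁ hvol hlam x₀' ψ' hψ') x₀ ψ hψ
  -- the source is its own block component; (D-E)₀,k
  -- the pseudo-metric
  have hδ0 : ∀ y y' : TSite d m, 0 ≤ tdist m y y' := fun y y' => tdist_nonneg m y y'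
  have hδt : ∀ u' y w : TSite d m, tdist m u' w ≤ tdist m u' y + tdist m y w := fun u' y w => tdist_triangle hm u' y w
  -- the remainder `q` in the STENCIL + `L^∞` form
  set pK : ℝ := 768 * Fintype.card (DirPair d) * Mτ * Mφ ^ 2 * (‖((η : ℂ)) ^ d‖ / c₀) * ‖((η : ℂ))⁻¹‖ ^ 2 * δ with hpK
  set pinf : ℝ := pK + ‖((η : ℂ))⁻¹ * ((η : ℂ))⁻¹‖ * ((d - 1 : ℝ) * δK) with hpinf_def
  set p₂ : ℝ := |a| * (Mφ' * Mφ * Real.exp (100 * d * (d + 1) * (L : ℝ) ^ d * AQ) * ((2 * d : ℕ) : ℝ) *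
      ((Mφ' * Mφ * Real.exp (Real.sqrt ((L : ℝ) ^ d) * (Real.sqrt (2 * d) * (102 * (d + 1) ^ 2 * L)) * (εs / (1 - r)))) / Real.sqrt c₁ * 2))
    with hp₂_def
  have hd1 : (0 : ℝ) ≤ d - 1 := sub_nonneg.mpr (by exact_mod_cast hd)
  have hpinf0 : 0 ≤ pinf := by positivity
  have hp₂0 : 0 ≤ p₂ := by positivity
  let st : Bond d (towerP L m (n + 1)) → Option (Fin d × Bool) → TSite d m := fun b i =>
    Option.elim i (π b) (fun p => if p.2 then shift p.1 (π b) else unshift p.1 (π b))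
  let near : Bond d (towerP L m (n + 1)) → Bond d (towerP L m (n + 1)) → Prop := fun b b' =>
    (∃ (x : TSite d (towerP L m (n + 1))) (q : DirPair d),
      (b = (x, q.1.1) ∨ b = (x, q.1.2) ∨ b = (shift q.1.1 x, q.1.2) ∨ b = (shift q.1.2 x, q.1.1)) ∧
      (b' = (x, q.1.1) ∨ b' = (x, q.1.2) ∨ b' = (shift q.1.1 x, q.1.2) ∨ b' = (shift q.1.2 x, q.1.1))) ∨
    (∃ ν, b' = (shift b.2 (unshift ν b.1), ν))
  have hnear : ∀ b b', near b b' → tdist m (π b) (π b') ≤ 2 := by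
    intro b b' hbb'
    refine tdist_bigBlock_le_two_of_le_two L m n hm ?_
    rcases hbb' with ⟨x, qq, hb, hb'⟩ | ⟨ν, hb'⟩
    · exact tdist_plaq_le_two L m n hm x qq b b' hb hb'
    · rw [hb']; exact tdist_corner_le_two L m n hm b.1 b.2 ν
  have hst : ∀ b i, tdist m (π b) (st b i) ≤ 1 := fun b i => tdist_stencil_le_one m hm (π b) i
  have hq : ∀ (b : Bond d (towerP L m (n + 1))) (Mx : ℝ), 0 ≤ Mx → (∀ b', near b b' → ‖WL2.equiv ℂ _ W (G f) b'‖ ≤ Mx) →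
      ‖WL2.equiv ℂ _ W q b‖ ≤ p₂ * ∑ i, ‖PB (st b i) (G f)‖ + pinf * Mx := by
    intro b Mx hMx hnb
    rw [hGf] at hnb ⊢
    -- split `q = Δ′u + Q†(a•Q)u − η⁻²𝒦u`
    have e : WL2.equiv ℂ _ W q b = WL2.equiv ℂ _ W (curvOp φ τ η U u) b +
        WL2.equiv ℂ _ W ((LinearMap.adjoint (QkW L m n φ U hL α hα1 hU1 hreg (c₀ := c₀) (c₁ := c₁)) ∘ₗ
          ((a : ℂ) • QkW L m n φ U hL α hα1 hU1 hreg (c₀ := c₀) (c₁ := c₁))) u) b -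
        WL2.equiv ℂ _ W ((((η : ℂ))⁻¹ * ((η : ℂ))⁻¹) • weitzOpK ℂ c₀ (adTransportW φ U) (adTransportW φ fun b => (U b)⁻¹) u) b := by
      rw [hq_def]
      simp only [LinearMap.sub_apply, LinearMap.add_apply, LinearMap.smul_apply, WL2.equiv_sub, WL2.equiv_add, Pi.sub_apply, Pi.add_apply]
    -- the `Δ′` letter, local
    have h1 : ‖WL2.equiv ℂ _ W (curvOp φ τ η U u) b‖ ≤ pK * Mx := by
      refine norm_apply_curvOp_le_local φ hφ hMφ hstar τ hτ hMτ η U hU hδ hRe hIm u b hMx fun x qq hb => ?_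
      have hM4 : ∀ b', (b' = (x, qq.1.1) ∨ b' = (x, qq.1.2) ∨ b' = (shift qq.1.1 x, qq.1.2) ∨ b' = (shift qq.1.2 x, qq.1.1)) →
          ‖WL2.equiv ℂ _ W u b'‖ ≤ Mx := fun b' hb' => hnb b' (Or.inl ⟨x, qq, hb, hb'⟩)
      linarith [hM4 _ (Or.inl rfl), hM4 _ (Or.inr (Or.inl rfl)), hM4 _ (Or.inr (Or.inr (Or.inl rfl))), hM4 _ (Or.inr (Or.inr (Or.inr rfl)))]
    -- the penalty, stencil (PSK)
    have h2 : ‖WL2.equiv ℂ _ W ((LinearMap.adjoint (QkW L m n φ U hL α hα1 hU1 hreg (c₀ := c₀) (c₁ := c₁)) ∘ₗ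
          ((a : ℂ) • QkW L m n φ U hL α hα1 hU1 hreg (c₀ := c₀) (c₁ := c₁))) u) b‖ ≤ p₂ * ∑ i, ‖PB (st b i) u‖ := by
      have h := norm_penalty_QkW_apply_le_stencil L m n φ U hL α hα0 hα1 hU1 hreg hMφ hφ hMφ' hφ' εU hεU hUε hr0 hr1 hεs hεg hPB hAQ hw a u b
      rw [hp₂_def]
      refine h.trans (le_of_eq ?_)
      ring
    -- the Weitzenböck remainder, local
    have h3 : ‖WL2.equiv ℂ _ W ((((η : ℂ))⁻¹ * ((η : ℂ))⁻¹) • weitzOpK ℂ c₀ (adTransportW φ U) (adTransportW φ fun b => (U b)⁻¹) u) b‖ ≤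
        ‖((η : ℂ))⁻¹ * ((η : ℂ))⁻¹‖ * ((d - 1 : ℝ) * δK * Mx) := by
      rw [WL2.equiv_smul, Pi.smul_apply, norm_smul]
      refine mul_le_mul_of_nonneg_left ?_ (norm_nonneg _)
      rw [equiv_weitzOpK]
      obtain ⟨x, μ'⟩ := b
      have hRS' : ∀ (b' : Bond d (towerP L m (n + 1))) (w : W), adTransportW φ U b' (adTransportW φ (fun b => (U b)⁻¹) b' w) = w :=
        fun b' w => by
          have h := B9Eq342GreenPrimeSupBound.adTransportW_inv_adTransportW φ (fun b => (U b)⁻¹) b' w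
          simp only [inv_inv] at h
          exact h
      refine norm_weitzOp_apply_le_local (adTransportW φ U) (adTransportW φ fun b => (U b)⁻¹)
        (fun b' w => B9Eq342GreenPrimeSupBound.adTransportW_inv_adTransportW φ U b' w) hRS' hδK hHol _ x μ' fun ν _ => ?_
      exact hnb _ (Or.inr ⟨ν, rfl⟩)
    rw [e]
    calc ‖WL2.equiv ℂ _ W (curvOp φ τ η U u) (b) +
          WL2.equiv ℂ _ W ((LinearMap.adjoint (QkW L m n φ U hL α hα1 hU1 hreg (c₀ := c₀) (c₁ := c₁)) ∘ₗ
            ((a : ℂ) • QkW L m n φ U hL α hα1 hU1 hreg (c₀ := c₀) (c₁ := c₁))) u) b -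
          WL2.equiv ℂ _ W ((((η : ℂ))⁻¹ * ((η : ℂ))⁻¹) • weitzOpK ℂ c₀ (adTransportW φ U) (adTransportW φ fun b => (U b)⁻¹) u) b‖
        ≤ ‖WL2.equiv ℂ _ W (curvOp φ τ η U u) b‖ +
            ‖WL2.equiv ℂ _ W ((LinearMap.adjoint (QkW L m n φ U hL α hα1 hU1 hreg (c₀ := c₀) (c₁ := c₁)) ∘ₗ
              ((a : ℂ) • QkW L m n φ U hL α hα1 hU1 hreg (c₀ := c₀) (c₁ := c₁))) u) b‖ +
            ‖WL2.equiv ℂ _ W ((((η : ℂ))⁻¹ * ((η : ℂ))⁻¹) • weitzOpK ℂ c₀ (adTransportW φ U) (adTransportW φ fun b => (U b)⁻¹) u) b‖ :=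
          (norm_sub_le _ _).trans (add_le_add (norm_add_le _ _) le_rfl)
      _ ≤ pK * Mx + p₂ * ∑ i, ‖PB (st b i) u‖ + ‖((η : ℂ))⁻¹ * ((η : ℂ))⁻¹‖ * ((d - 1 : ℝ) * δK * Mx) := add_le_add (add_le_add h1 h2) h3
      _ = p₂ * ∑ i, ‖PB (st b i) u‖ + pinf * Mx := by rw [hpinf_def]; ring
  -- the volume-free sum letter
  have hS : ∀ y : TSite d m, ∑ y', Real.exp (-((afine * (L : ℝ) ^ (n + 1) - 2 * a') * tdist m y y')) ≤
      latticeConst d (afine * (L : ℝ) ^ (n + 1) - 2 * a') := fun y => torusSum_le d hm (by linarith) y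
  -- (WKP)
  have hmain := norm_apply_le_decay_of_letters_stencil (𝕜 := ℂ) (P := PB) (π := π) hPB (δ := tdist m) hδ0 hδt nbr (fun _ _ => (η⁻¹) ^ 2)
    (fun _ _ => sq_nonneg _) T hT one_pos (W := Wf) hW0 hlam hsup hx₀ (by positivity) hWd G hfv hF0 hF hμ hCE hdec near st hnear hst hu hp₂0 hpinf0
    hq ha' ha'κ ha'κ₁ hC₃ hFS hS ?_ b₀
  · refine hmain.trans (le_of_eq ?_)
    simp only [Fintype.card_option, one_div, π]
  · -- the contraction window
    simpa only [one_div] using hθ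

end Instance

end Literature.MathematicalPhysics.QuantumFieldTheory.Balaban1983to89.B9Eq326LocalPartTowerSupDecay

end
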